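import Summits.QuantumFields.YangMills.Theorems.FluctuationComparisonRegPrIntLS2BetaLiftOfCriticalOrbitUnique
import Summits.QuantumFields.YangMills.Theorems.FluctuationComparisonRegPrIntLS2BetaAbelianMinimiserOfRegAb
import HarnessLib

/-!
# S2β · TUBE♭ ∕ GAP♭ AT **EVERY** SMALL DATUM, `L ≥ 5`, MODULO px12's ONE ANALYTIC ABELIAN LETTER REG^{ab} (regularity of the σ₃-diagonal constrained minimisers)

Cell `ym3-torus` (YM ladder rung R3 = continuum `SU(2)` Yang–Mills on T³ at fixed lattice data — NOT d = 4, NOT infinite volume, NOT a mass gap, NOT Clay).  Width seat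
`ym3-torus-px17` (gen 16), FREE px helper of crux `stmt-QuantumFields-20520`; `--supports … --as helper`, count-neutral, DEFINITION-FREE (0 `def`∕`instance`∕`notation`, default heartbeats).

WHAT.  ✓`…S2BetaLiftOfCriticalOrbitUnique` (this seat, FILE 3) §3: GAP♭(V,U₀) ∕ small-tube TUBE♭(V,U₀) at print's regular minimiser ⟸ PROP. 7 CLAUSE 1 at `(e, V)` ALONE.  ✓px12 g21
(B) FILE 7 `…S2BetaAbelianMinimiserOfRegAb`: Prop. 7 cl. 1 at EVERY small datum `V`, `L ≥ 5` — ★`atMostOneCriticalOrbit_five_of_regAb` (datum `PlaqSmall δ ≤ 2`, letters NE^{ab} ∧ REG^{ab} at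
the σ₃-diagonal case-A representatives `g • V`) and ★`atMostOneCriticalOrbit_five_of_regAb_small` (datum `PlaqSmall ε₁`, `(π∕2)ε₁ ≤ (10⁸L²)⁻¹`, `4·10⁶·(π∕2)ε₁ ≤ e`; letter REG^{ab}
ALONE — «every minimiser of the Wilson action over the CLOSURE of the σ₃-diagonal part of `regFibrePr F n K e (g • V)` is strictly `(6)(e)`-regular»).  THIS FILE is the composition,
with px12's admissibility rows `143·(49∕4)²·e ≤ 1∕3`, `2e ≤ 2δ₂∕(7L)²` DISCHARGED into the threshold (✓px13 `exists_ePi`); px12's NE^{ab}∕REG^{ab} rows VERBATIM: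
* §1 ★★★★ `gapFlat_at_min_five_of_regAb` — GAP♭(V,U₀) at every `2`-small datum ⟸ {NE^{ab}, REG^{ab}}@diag(V), per-base-point `γ ≤ γ*(U₀)`;
* §2 ★★★★ `gapFlat_at_min_five_of_regAb_small` — GAP♭(V,U₀) at every `ε₁`-small datum ⟸ REG^{ab}@diag(V) ALONE, per-base-point `γ*`;
* §3 ★★★ `gapFlat_at_min_of_hreg_five_of_regAb_small` — the same ⟸ {REG^{ab}@diag(V), `hreg`(δ')} UNIFORMLY in `γ ≤ γ*(L,b₀,p₀,δ')`;
* §4 ★★★ `tubeGrowth_smallTube_at_min_of_CL_five_of_regAb_small` — `∃ δ₀ > 0, ∀ δ' ≤ δ₀`, TUBE♭(V,U₀;δ') ⟸ {REG^{ab}@diag(V), CL(V)}.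
STATE OF THE PER-DATUM GAP♭ ROAD after this file: at every `ε₁`-small datum, `L ≥ 5`, the letters are REG^{ab} (ONE analytic abelian letter — [Balaban1984PropagatorsI]-type sup-norm
regularity of the constrained ABELIAN minimiser; L, unstaffed) + the base-point rows {`U₀ ∈ regFibrePr e V`, `A U₀ = minActionRegPr e V`} (EXW∘'s).  NOT done: REG^{ab}, the organ's
datum-free `δ`∕`γ` and K-uniform `μ` (TUBE-REG∘ ∕ GAP♯∘ as registered — RECORD 17gh), EXW∘.

HONEST: composition BY NAME; nothing of Bałaban's analysis beyond the cited tree theorems; REG^{ab}, `hreg` at general δ', TUBE-REG∘'s uniform order, GAP♯∘, EXW∘, S2β, crux 20520 NOT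
proved; `L = 3` socket open (EMBARGO-LITE №58); no summit statement is proved by a helper; finite-volume ∕ conditional; rung R3 = SU(2) YM₃ on T³ — NOT d = 4, NOT infinite volume, NOT a
mass gap, NOT Clay; the Yang–Mills mass gap is NOT proved.  No `sorry`, axioms standard.

References: T. Bałaban, CMP **102** (1985) 277–309 [Balaban1985Variational] ((2)–(7) p.278, Thm 1 (8)–(10) p.279, (13)–(14) p.280, Prop. 7 and (141)–(143) p.299); CMP **102** (1985)
255–275 [Balaban1985UV3] ((12)–(13) p.259, (18)–(22) p.260); CMP **98** (1985) 17–51 [Balaban1985Averaging] ((8)–(13) p.19, (19)–(24) p.21); CMP **95** (1984) 17–40 [Balaban1984PropagatorsI].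
-/

set_option autoImplicit false

noncomputable section

namespace Summit.QuantumFields.YangMills.Theorems.FluctuationComparisonRegPrIntLS2BetaGapFlatOfRegAb

open Set Filter Topology Function
open scoped Matrix.Norms.L2Operator
open Literature.MathematicalPhysics.QuantumFieldTheory.Balaban1983to89
open Literature.MathematicalPhysics.QuantumFieldTheory.Balaban1983to89.T3ContinuumYM3Torus
open Literature.MathematicalPhysics.QuantumFieldTheory.Balaban1983to89.T3UnitLawDensityEML (ℰp)
open Literature.MathematicalPhysics.QuantumFieldTheory.Balaban1983to89.T3UnitScaleTilt
open Literature.MathematicalPhysics.QuantumFieldTheory.Balaban1983to89.T3TiltDescent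
open Literature.MathematicalPhysics.QuantumFieldTheory.Balaban1983to89.T3ConstrainedMinimiser (fibre)
open Literature.MathematicalPhysics.QuantumFieldTheory.Balaban1983to89.T3PrintedRegularMinimiser
open Literature.MathematicalPhysics.QuantumFieldTheory.Balaban1983to89.T4Continuum
open Literature.MathematicalPhysics.QuantumFieldTheory.Balaban1983to89.ExpMeanLog (deltaSU)
open Literature.MathematicalPhysics.QuantumFieldTheory.Balaban1983to89.B9AdOrthogonal (σ₃)
open Literature.MathematicalPhysics.QuantumFieldTheory.Balaban1983to89.B10Eq27TorusAxialLog (unitsField toUField)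
open scoped Literature.MathematicalPhysics.QuantumFieldTheory.Balaban1983to89.T3OrbitAverage
open Summit.QuantumFields.YangMills.Theorems.FluctuationComparisonRegPrIntLS2BetaDescentLipschitz (exists_ePi)
open Summit.QuantumFields.YangMills.Theorems.FluctuationComparisonRegPrIntLS2BetaLiftOfCriticalOrbitUnique
open Summit.QuantumFields.YangMills.Theorems.FluctuationComparisonRegPrIntLS2BetaAbelianMinimiserOfRegAb
  (atMostOneCriticalOrbit_five_of_regAb atMostOneCriticalOrbit_five_of_regAb_small)

/-! ## §1 GAP♭ at every `2`-small datum from NE^{ab} ∧ REG^{ab} at the diagonal representatives -/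

section TwoSmall

/-- ★★★★ **GAP♭(V,U₀) AT EVERY `2`-SMALL DATUM ⟸ {NE^{ab}, REG^{ab}} AT THE σ₃-DIAGONAL CASE-A REPRESENTATIVES OF `V`, for all `γ ≤ γ*(U₀)`** (GAP♭ text VERBATIM;
px12's letters VERBATIM; per-base-point `γ*`).  ✓FILE 3 `gapFlat_at_min_of_atMostOneCriticalOrbit_five` ∘ ✓px12 `atMostOneCriticalOrbit_five_of_regAb`; px12's admissibility rows by ✓`exists_ePi`.
[cite: Balaban1985Variational, (2)-(7) p.278, Thm 1 (8)-(10) p.279, Prop. 7 and (141)-(143) p.299; Balaban1985UV3, (12)-(13) p.259 and (18)-(22) p.260; Balaban1985Averaging, (8)-(13) p.19] -/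
theorem gapFlat_at_min_five_of_regAb (L : ℕ) (h5 : 5 ≤ L) (b₀ p₀ : ℝ) (hb : 0 < b₀) (hp : 0 < p₀) :
    ∃ e₉ : ℝ, 0 < e₉ ∧ ∀ (F : T3Family), F.L = L → ∀ (n K : ℕ) (hnK : n < K) (e : ℝ)
      (V : GaugeField (F.P n) 0 (Matrix.specialUnitaryGroup (Fin 2) ℂ)) (δ : ℝ),
      0 < e → e ≤ e₉ → δ ≤ 2 → PlaqSmall δ V →
      (∀ g : GaugeTransf (F.P n) 0 (Matrix.specialUnitaryGroup (Fin 2) ℂ),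
        (∀ e' : PBond (F.P n) 0, Commute ((GaugeField.gaugeAct g V e' : Matrix.specialUnitaryGroup (Fin 2) ℂ) : Matrix (Fin 2) (Fin 2) ℂ) σ₃) →
        (∀ c : Site (F.P n) 0 → Matrix (Fin 2) (Fin 2) ℂ,
          (∀ e' : PBond (F.P n) 0, c e'.src = ((unitsField (toUField (GaugeField.gaugeAct g V)) e' : (Matrix (Fin 2) (Fin 2) ℂ)ˣ) : Matrix (Fin 2) (Fin 2) ℂ) * c e'.tgt *
            (((unitsField (toUField (GaugeField.gaugeAct g V)) e')⁻¹ : (Matrix (Fin 2) (Fin 2) ℂ)ˣ) : Matrix (Fin 2) (Fin 2) ℂ)) →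
          ∃ c₀ : Matrix (Fin 2) (Fin 2) ℂ, (∀ y, c y = c₀) ∧ Commute c₀ σ₃) →
        (∃ W : GaugeField (F.P K) 0 (Matrix.specialUnitaryGroup (Fin 2) ℂ),
          (∀ b, Commute ((W b : Matrix.specialUnitaryGroup (Fin 2) ℂ) : Matrix (Fin 2) (Fin 2) ℂ) σ₃) ∧ W ∈ regFibrePr F n K hnK.le e (GaugeField.gaugeAct g V)) ∧
        (∀ W₀ ∈ closure {W : GaugeField (F.P K) 0 (Matrix.specialUnitaryGroup (Fin 2) ℂ) |
            (∀ b, Commute ((W b : Matrix.specialUnitaryGroup (Fin 2) ℂ) : Matrix (Fin 2) (Fin 2) ℂ) σ₃) ∧ W ∈ regFibrePr F n K hnK.le e (GaugeField.gaugeAct g V)},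
          IsMinOn wilsonAction4 (closure {W : GaugeField (F.P K) 0 (Matrix.specialUnitaryGroup (Fin 2) ℂ) |
            (∀ b, Commute ((W b : Matrix.specialUnitaryGroup (Fin 2) ℂ) : Matrix (Fin 2) (Fin 2) ℂ) σ₃) ∧ W ∈ regFibrePr F n K hnK.le e (GaugeField.gaugeAct g V)}) W₀ →
          RegPr F n K e W₀)) →
      ∀ U₀ : GaugeField (F.P K) 0 (Matrix.specialUnitaryGroup (Fin 2) ℂ), U₀ ∈ regFibrePr F n K hnK.le e V →
        wilsonAction4 U₀ = minActionRegPr F n K hnK.le e V →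
        ∃ γs : ℝ, 0 < γs ∧ ∀ (γ : ℝ), 0 < γ → γ ≤ γs → U₀ ∈ histGood F ℰp (θBal F.L γ b₀ p₀) K n →
        ∃ μ : ℝ, 0 < μ ∧ ∀ U ∈ fibre F ℰp n K hnK.le V, U ∈ histGood F ℰp (θBal F.L γ b₀ p₀) K n →
          μ * ((F.L : ℝ)⁻¹) ^ (2 * (K - n)) *
              (⨅ w : {w : Site (F.P K) 0 → Matrix.specialUnitaryGroup (Fin 2) ℂ |
                  ∀ U : GaugeField (F.P K) 0 (Matrix.specialUnitaryGroup (Fin 2) ℂ),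
                    descendTo F ℰp n K hnK.le (GaugeField.gaugeAct w U) = descendTo F ℰp n K hnK.le U},
                ∑ ℓ : PBond (F.P K) 0,
                  dist1 (U ℓ * ((GaugeField.gaugeAct (w : Site (F.P K) 0 → Matrix.specialUnitaryGroup (Fin 2) ℂ) U₀) ℓ)⁻¹) ^ 2)
            ≤ wilsonAction4 U - minActionRegPr F n K hnK.le e V := by
  obtain ⟨e₈, he₈, H⟩ := gapFlat_at_min_of_atMostOneCriticalOrbit_five L h5 b₀ p₀ hb hp
  obtain ⟨e₈', he₈', H1⟩ := atMostOneCriticalOrbit_five_of_regAb L h5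
  obtain ⟨eπ, heπ, Hπ⟩ := exists_ePi L (by omega)
  refine ⟨min e₈ (min e₈' eπ), lt_min he₈ (lt_min he₈' heπ), ?_⟩
  intro F hF n K hnK e V δ he hee hδ hV hNR U₀ hU₀reg hmin
  obtain ⟨hr3, hr2, -⟩ := Hπ e he (hee.trans ((min_le_right _ _).trans (min_le_right _ _)))
  rw [← hF] at hr2
  have h1 := H1 F hF n K hnK e V δ he (hee.trans ((min_le_right _ _).trans (min_le_left _ _))) hr3 hr2 hδ hV hNR
  exact H F hF n K hnK e V U₀ he (hee.trans (min_le_left _ _)) hU₀reg hmin h1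

end TwoSmall

/-! ## §2 GAP♭ ∕ TUBE♭ at every `ε₁`-small datum from REG^{ab} alone -/

section Small

/-- ★★★★ **GAP♭(V,U₀) AT EVERY `ε₁`-SMALL DATUM ⟸ REG^{ab} AT THE σ₃-DIAGONAL CASE-A REPRESENTATIVES OF `V` ALONE, for all `γ ≤ γ*(U₀)`** (`(π∕2)ε₁ ≤ (10⁸L²)⁻¹`,
`4·10⁶·(π∕2)ε₁ ≤ e`; GAP♭ text VERBATIM; REG^{ab} VERBATIM; per-base-point `γ*`).  ✓FILE 3 `gapFlat_at_min_of_atMostOneCriticalOrbit_five` ∘ ✓px12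
`atMostOneCriticalOrbit_five_of_regAb_small`.  The END of the per-datum GAP♭ road: ONE analytic letter (REG^{ab}) + EXW∘'s base-point rows.
[cite: Balaban1985Variational, (2)-(7) p.278, Thm 1 (8)-(10) p.279, (13)-(14) p.280, Prop. 7 and (141)-(143) p.299; Balaban1985UV3, (12)-(13) p.259 and (18)-(22) p.260; Balaban1985Averaging, (19)-(24) p.21] -/
theorem gapFlat_at_min_five_of_regAb_small (L : ℕ) (h5 : 5 ≤ L) (b₀ p₀ : ℝ) (hb : 0 < b₀) (hp : 0 < p₀) :
    ∃ e₉ : ℝ, 0 < e₉ ∧ ∀ (F : T3Family), F.L = L → ∀ (n K : ℕ) (hnK : n < K) (e : ℝ)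
      (V : GaugeField (F.P n) 0 (Matrix.specialUnitaryGroup (Fin 2) ℂ)) (ε₁ : ℝ),
      0 < e → e ≤ e₉ → 0 < ε₁ → Real.pi / 2 * ε₁ ≤ ((10 : ℝ) ^ 8 * (F.L : ℝ) ^ 2)⁻¹ → 4000000 * (Real.pi / 2 * ε₁) ≤ e → PlaqSmall ε₁ V →
      (∀ g : GaugeTransf (F.P n) 0 (Matrix.specialUnitaryGroup (Fin 2) ℂ),
        (∀ e' : PBond (F.P n) 0, Commute ((GaugeField.gaugeAct g V e' : Matrix.specialUnitaryGroup (Fin 2) ℂ) : Matrix (Fin 2) (Fin 2) ℂ) σ₃) →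
        (∀ c : Site (F.P n) 0 → Matrix (Fin 2) (Fin 2) ℂ,
          (∀ e' : PBond (F.P n) 0, c e'.src = ((unitsField (toUField (GaugeField.gaugeAct g V)) e' : (Matrix (Fin 2) (Fin 2) ℂ)ˣ) : Matrix (Fin 2) (Fin 2) ℂ) * c e'.tgt *
            (((unitsField (toUField (GaugeField.gaugeAct g V)) e')⁻¹ : (Matrix (Fin 2) (Fin 2) ℂ)ˣ) : Matrix (Fin 2) (Fin 2) ℂ)) →
          ∃ c₀ : Matrix (Fin 2) (Fin 2) ℂ, (∀ y, c y = c₀) ∧ Commute c₀ σ₃) →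
        ∀ W₀ ∈ closure {W : GaugeField (F.P K) 0 (Matrix.specialUnitaryGroup (Fin 2) ℂ) |
            (∀ b, Commute ((W b : Matrix.specialUnitaryGroup (Fin 2) ℂ) : Matrix (Fin 2) (Fin 2) ℂ) σ₃) ∧ W ∈ regFibrePr F n K hnK.le e (GaugeField.gaugeAct g V)},
          IsMinOn wilsonAction4 (closure {W : GaugeField (F.P K) 0 (Matrix.specialUnitaryGroup (Fin 2) ℂ) |
            (∀ b, Commute ((W b : Matrix.specialUnitaryGroup (Fin 2) ℂ) : Matrix (Fin 2) (Fin 2) ℂ) σ₃) ∧ W ∈ regFibrePr F n K hnK.le e (GaugeField.gaugeAct g V)}) W₀ →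
          RegPr F n K e W₀) →
      ∀ U₀ : GaugeField (F.P K) 0 (Matrix.specialUnitaryGroup (Fin 2) ℂ), U₀ ∈ regFibrePr F n K hnK.le e V →
        wilsonAction4 U₀ = minActionRegPr F n K hnK.le e V →
        ∃ γs : ℝ, 0 < γs ∧ ∀ (γ : ℝ), 0 < γ → γ ≤ γs → U₀ ∈ histGood F ℰp (θBal F.L γ b₀ p₀) K n →
        ∃ μ : ℝ, 0 < μ ∧ ∀ U ∈ fibre F ℰp n K hnK.le V, U ∈ histGood F ℰp (θBal F.L γ b₀ p₀) K n →
          μ * ((F.L : ℝ)⁻¹) ^ (2 * (K - n)) *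
              (⨅ w : {w : Site (F.P K) 0 → Matrix.specialUnitaryGroup (Fin 2) ℂ |
                  ∀ U : GaugeField (F.P K) 0 (Matrix.specialUnitaryGroup (Fin 2) ℂ),
                    descendTo F ℰp n K hnK.le (GaugeField.gaugeAct w U) = descendTo F ℰp n K hnK.le U},
                ∑ ℓ : PBond (F.P K) 0,
                  dist1 (U ℓ * ((GaugeField.gaugeAct (w : Site (F.P K) 0 → Matrix.specialUnitaryGroup (Fin 2) ℂ) U₀) ℓ)⁻¹) ^ 2)
            ≤ wilsonAction4 U - minActionRegPr F n K hnK.le e V := by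
  obtain ⟨e₈, he₈, H⟩ := gapFlat_at_min_of_atMostOneCriticalOrbit_five L h5 b₀ p₀ hb hp
  obtain ⟨e₈', he₈', H1⟩ := atMostOneCriticalOrbit_five_of_regAb_small L h5
  obtain ⟨eπ, heπ, Hπ⟩ := exists_ePi L (by omega)
  refine ⟨min e₈ (min e₈' eπ), lt_min he₈ (lt_min he₈' heπ), ?_⟩
  intro F hF n K hnK e V ε₁ he hee hε₁ hε₁L hε₁e hV hREG U₀ hU₀reg hmin
  obtain ⟨hr3, hr2, -⟩ := Hπ e he (hee.trans ((min_le_right _ _).trans (min_le_right _ _)))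
  rw [← hF] at hr2
  have h1 := H1 F hF n K hnK e V ε₁ he (hee.trans ((min_le_right _ _).trans (min_le_left _ _))) hr3 hr2 hε₁ hε₁L hε₁e hV hREG
  exact H F hF n K hnK e V U₀ he (hee.trans (min_le_left _ _)) hU₀reg hmin h1

/-- ★★★ **GAP♭(V,U₀) AT EVERY `ε₁`-SMALL DATUM ⟸ {REG^{ab}@diag(V), `hreg`(δ')}, UNIFORMLY IN `γ ≤ γ*(L,b₀,p₀,δ')`** (GAP♭ and `hreg` texts VERBATIM).
✓FILE 3 `gapFlat_at_min_of_atMostOneCriticalOrbit_of_hreg_five` ∘ ✓px12 `atMostOneCriticalOrbit_five_of_regAb_small`.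
[cite: Balaban1985Variational, (2)-(7) p.278, Thm 1 (8)-(10) p.279, Prop. 7 and (141)-(143) p.299; Balaban1985UV3, (12)-(13) p.259 and (18)-(22) p.260] -/
theorem gapFlat_at_min_of_hreg_five_of_regAb_small (L : ℕ) (h5 : 5 ≤ L) (b₀ p₀ : ℝ) (hb : 0 < b₀) (hp : 0 < p₀) (δ' : ℝ) (hδ' : 0 < δ') :
    ∃ e₉ γs : ℝ, 0 < e₉ ∧ 0 < γs ∧
      ∀ (F : T3Family) (γ : ℝ), F.L = L → 0 < γ → γ ≤ γs → ∀ (n K : ℕ) (hnK : n < K) (e : ℝ)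
      (V : GaugeField (F.P n) 0 (Matrix.specialUnitaryGroup (Fin 2) ℂ)) (ε₁ : ℝ),
      0 < e → e ≤ e₉ → 0 < ε₁ → Real.pi / 2 * ε₁ ≤ ((10 : ℝ) ^ 8 * (F.L : ℝ) ^ 2)⁻¹ → 4000000 * (Real.pi / 2 * ε₁) ≤ e → PlaqSmall ε₁ V →
      (∀ g : GaugeTransf (F.P n) 0 (Matrix.specialUnitaryGroup (Fin 2) ℂ),
        (∀ e' : PBond (F.P n) 0, Commute ((GaugeField.gaugeAct g V e' : Matrix.specialUnitaryGroup (Fin 2) ℂ) : Matrix (Fin 2) (Fin 2) ℂ) σ₃) →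
        (∀ c : Site (F.P n) 0 → Matrix (Fin 2) (Fin 2) ℂ,
          (∀ e' : PBond (F.P n) 0, c e'.src = ((unitsField (toUField (GaugeField.gaugeAct g V)) e' : (Matrix (Fin 2) (Fin 2) ℂ)ˣ) : Matrix (Fin 2) (Fin 2) ℂ) * c e'.tgt *
            (((unitsField (toUField (GaugeField.gaugeAct g V)) e')⁻¹ : (Matrix (Fin 2) (Fin 2) ℂ)ˣ) : Matrix (Fin 2) (Fin 2) ℂ)) →
          ∃ c₀ : Matrix (Fin 2) (Fin 2) ℂ, (∀ y, c y = c₀) ∧ Commute c₀ σ₃) →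
        ∀ W₀ ∈ closure {W : GaugeField (F.P K) 0 (Matrix.specialUnitaryGroup (Fin 2) ℂ) |
            (∀ b, Commute ((W b : Matrix.specialUnitaryGroup (Fin 2) ℂ) : Matrix (Fin 2) (Fin 2) ℂ) σ₃) ∧ W ∈ regFibrePr F n K hnK.le e (GaugeField.gaugeAct g V)},
          IsMinOn wilsonAction4 (closure {W : GaugeField (F.P K) 0 (Matrix.specialUnitaryGroup (Fin 2) ℂ) |
            (∀ b, Commute ((W b : Matrix.specialUnitaryGroup (Fin 2) ℂ) : Matrix (Fin 2) (Fin 2) ℂ) σ₃) ∧ W ∈ regFibrePr F n K hnK.le e (GaugeField.gaugeAct g V)}) W₀ →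
          RegPr F n K e W₀) →
      ∀ U₀ : GaugeField (F.P K) 0 (Matrix.specialUnitaryGroup (Fin 2) ℂ), U₀ ∈ regFibrePr F n K hnK.le e V →
        wilsonAction4 U₀ = minActionRegPr F n K hnK.le e V → U₀ ∈ histGood F ℰp (θBal F.L γ b₀ p₀) K n →
        (∀ U ∈ closure (fibre F ℰp n K hnK.le V ∩ histGood F ℰp (θBal F.L γ b₀ p₀) K n),
            (∃ w : Site (F.P K) 0 → Matrix.specialUnitaryGroup (Fin 2) ℂ,
              (∀ U'' : GaugeField (F.P K) 0 (Matrix.specialUnitaryGroup (Fin 2) ℂ),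
                  descendTo F ℰp n K hnK.le (GaugeField.gaugeAct w U'') = descendTo F ℰp n K hnK.le U'') ∧
                ∀ ℓ : PBond (F.P K) 0, dist1 (U ℓ * ((GaugeField.gaugeAct w U₀) ℓ)⁻¹) ≤ δ') →
            wilsonAction4 U ≤ minActionRegPr F n K hnK.le e V → U ∈ regFibrePr F n K hnK.le e V) →
        ∃ μ : ℝ, 0 < μ ∧ ∀ U ∈ fibre F ℰp n K hnK.le V, U ∈ histGood F ℰp (θBal F.L γ b₀ p₀) K n →
          μ * ((F.L : ℝ)⁻¹) ^ (2 * (K - n)) *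
              (⨅ w : {w : Site (F.P K) 0 → Matrix.specialUnitaryGroup (Fin 2) ℂ |
                  ∀ U : GaugeField (F.P K) 0 (Matrix.specialUnitaryGroup (Fin 2) ℂ),
                    descendTo F ℰp n K hnK.le (GaugeField.gaugeAct w U) = descendTo F ℰp n K hnK.le U},
                ∑ ℓ : PBond (F.P K) 0,
                  dist1 (U ℓ * ((GaugeField.gaugeAct (w : Site (F.P K) 0 → Matrix.specialUnitaryGroup (Fin 2) ℂ) U₀) ℓ)⁻¹) ^ 2)
            ≤ wilsonAction4 U - minActionRegPr F n K hnK.le e V := by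
  obtain ⟨e₈, γ₁, he₈, hγ₁, H⟩ := gapFlat_at_min_of_atMostOneCriticalOrbit_of_hreg_five L h5 b₀ p₀ hb hp δ' hδ'
  obtain ⟨e₈', he₈', H1⟩ := atMostOneCriticalOrbit_five_of_regAb_small L h5
  obtain ⟨eπ, heπ, Hπ⟩ := exists_ePi L (by omega)
  refine ⟨min e₈ (min e₈' eπ), γ₁, lt_min he₈ (lt_min he₈' heπ), hγ₁, ?_⟩
  intro F γ hF hγ hγle n K hnK e V ε₁ he hee hε₁ hε₁L hε₁e hV hREG U₀ hU₀reg hmin hU₀h hreg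
  obtain ⟨hr3, hr2, -⟩ := Hπ e he (hee.trans ((min_le_right _ _).trans (min_le_right _ _)))
  rw [← hF] at hr2
  have h1 := H1 F hF n K hnK e V ε₁ he (hee.trans ((min_le_right _ _).trans (min_le_left _ _))) hr3 hr2 hε₁ hε₁L hε₁e hV hREG
  exact H F γ hF hγ hγle n K hnK e V U₀ he (hee.trans (min_le_left _ _)) hU₀reg hmin hU₀h h1 hreg

/-- ★★★ **TUBE♭(V,U₀) FOR EVERY SMALL TUBE RADIUS AT EVERY `ε₁`-SMALL DATUM ⟸ {REG^{ab}@diag(V), CL(V)}** (TUBE♭ text VERBATIM; `δ₀` per base point).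
✓FILE 3 `tubeGrowth_smallTube_at_min_of_atMostOneCriticalOrbit_of_CL_five` ∘ ✓px12 `atMostOneCriticalOrbit_five_of_regAb_small`.
[cite: Balaban1985Variational, (2)-(7) p.278, Thm 1 (8)-(10) p.279, Prop. 7 and (141)-(143) p.299; Balaban1985UV3, (12)-(13) p.259 and (18)-(22) p.260] -/
theorem tubeGrowth_smallTube_at_min_of_CL_five_of_regAb_small (L : ℕ) (h5 : 5 ≤ L) :
    ∃ e₉ : ℝ, 0 < e₉ ∧ ∀ (F : T3Family), F.L = L → ∀ (n K : ℕ) (hnK : n < K) (γ b₀ p₀ e : ℝ)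
      (V : GaugeField (F.P n) 0 (Matrix.specialUnitaryGroup (Fin 2) ℂ)) (ε₁ : ℝ),
      0 < e → e ≤ e₉ → 0 < ε₁ → Real.pi / 2 * ε₁ ≤ ((10 : ℝ) ^ 8 * (F.L : ℝ) ^ 2)⁻¹ → 4000000 * (Real.pi / 2 * ε₁) ≤ e → PlaqSmall ε₁ V →
      (∀ g : GaugeTransf (F.P n) 0 (Matrix.specialUnitaryGroup (Fin 2) ℂ),
        (∀ e' : PBond (F.P n) 0, Commute ((GaugeField.gaugeAct g V e' : Matrix.specialUnitaryGroup (Fin 2) ℂ) : Matrix (Fin 2) (Fin 2) ℂ) σ₃) →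
        (∀ c : Site (F.P n) 0 → Matrix (Fin 2) (Fin 2) ℂ,
          (∀ e' : PBond (F.P n) 0, c e'.src = ((unitsField (toUField (GaugeField.gaugeAct g V)) e' : (Matrix (Fin 2) (Fin 2) ℂ)ˣ) : Matrix (Fin 2) (Fin 2) ℂ) * c e'.tgt *
            (((unitsField (toUField (GaugeField.gaugeAct g V)) e')⁻¹ : (Matrix (Fin 2) (Fin 2) ℂ)ˣ) : Matrix (Fin 2) (Fin 2) ℂ)) →
          ∃ c₀ : Matrix (Fin 2) (Fin 2) ℂ, (∀ y, c y = c₀) ∧ Commute c₀ σ₃) →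
        ∀ W₀ ∈ closure {W : GaugeField (F.P K) 0 (Matrix.specialUnitaryGroup (Fin 2) ℂ) |
            (∀ b, Commute ((W b : Matrix.specialUnitaryGroup (Fin 2) ℂ) : Matrix (Fin 2) (Fin 2) ℂ) σ₃) ∧ W ∈ regFibrePr F n K hnK.le e (GaugeField.gaugeAct g V)},
          IsMinOn wilsonAction4 (closure {W : GaugeField (F.P K) 0 (Matrix.specialUnitaryGroup (Fin 2) ℂ) |
            (∀ b, Commute ((W b : Matrix.specialUnitaryGroup (Fin 2) ℂ) : Matrix (Fin 2) (Fin 2) ℂ) σ₃) ∧ W ∈ regFibrePr F n K hnK.le e (GaugeField.gaugeAct g V)}) W₀ →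
          RegPr F n K e W₀) →
      ∀ U₀ : GaugeField (F.P K) 0 (Matrix.specialUnitaryGroup (Fin 2) ℂ), U₀ ∈ regFibrePr F n K hnK.le e V →
        wilsonAction4 U₀ = minActionRegPr F n K hnK.le e V →
        closure (fibre F ℰp n K hnK.le V ∩ histGood F ℰp (θBal F.L γ b₀ p₀) K n) ⊆ fibre F ℰp n K hnK.le V →
        ∃ δ₀ : ℝ, 0 < δ₀ ∧ ∀ δ' : ℝ, δ' ≤ δ₀ →
        ∃ μ : ℝ, 0 < μ ∧ ∀ U ∈ fibre F ℰp n K hnK.le V, U ∈ histGood F ℰp (θBal F.L γ b₀ p₀) K n →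
          (∃ w : Site (F.P K) 0 → Matrix.specialUnitaryGroup (Fin 2) ℂ,
              (∀ U'' : GaugeField (F.P K) 0 (Matrix.specialUnitaryGroup (Fin 2) ℂ),
                  descendTo F ℰp n K hnK.le (GaugeField.gaugeAct w U'') = descendTo F ℰp n K hnK.le U'') ∧
                ∀ ℓ : PBond (F.P K) 0, dist1 (U ℓ * ((GaugeField.gaugeAct w U₀) ℓ)⁻¹) ≤ δ') →
          μ * ((F.L : ℝ)⁻¹) ^ (2 * (K - n)) *
              (⨅ w : {w : Site (F.P K) 0 → Matrix.specialUnitaryGroup (Fin 2) ℂ |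
                  ∀ U : GaugeField (F.P K) 0 (Matrix.specialUnitaryGroup (Fin 2) ℂ),
                    descendTo F ℰp n K hnK.le (GaugeField.gaugeAct w U) = descendTo F ℰp n K hnK.le U},
                ∑ ℓ : PBond (F.P K) 0,
                  dist1 (U ℓ * ((GaugeField.gaugeAct (w : Site (F.P K) 0 → Matrix.specialUnitaryGroup (Fin 2) ℂ) U₀) ℓ)⁻¹) ^ 2)
            ≤ wilsonAction4 U - minActionRegPr F n K hnK.le e V := by
  obtain ⟨e₈, he₈, H⟩ := tubeGrowth_smallTube_at_min_of_atMostOneCriticalOrbit_of_CL_five L h5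
  obtain ⟨e₈', he₈', H1⟩ := atMostOneCriticalOrbit_five_of_regAb_small L h5
  obtain ⟨eπ, heπ, Hπ⟩ := exists_ePi L (by omega)
  refine ⟨min e₈ (min e₈' eπ), lt_min he₈ (lt_min he₈' heπ), ?_⟩
  intro F hF n K hnK γ b₀ p₀ e V ε₁ he hee hε₁ hε₁L hε₁e hV hREG U₀ hU₀reg hmin hCL
  obtain ⟨hr3, hr2, -⟩ := Hπ e he (hee.trans ((min_le_right _ _).trans (min_le_right _ _)))
  rw [← hF] at hr2
  have h1 := H1 F hF n K hnK e V ε₁ he (hee.trans ((min_le_right _ _).trans (min_le_left _ _))) hr3 hr2 hε₁ hε₁L hε₁e hV hREG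
  exact H F hF n K hnK γ b₀ p₀ e V U₀ he (hee.trans (min_le_left _ _)) hU₀reg hmin h1 hCL

end Small

end Summit.QuantumFields.YangMills.Theorems.FluctuationComparisonRegPrIntLS2BetaGapFlatOfRegAb

end
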